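import Summits.Ventures.HodgeRepro2.T5BergmanGodementU11
import Summits.Ventures.HodgeRepro2.T5U11RuhlMeasure

/-!
# Godement's convolution identity on `U(1,1)` against Rühl's measure `μ_{U,R}`, constant-free

`T5BergmanGodementU11` proved the convolution identity on `H_j = U(1,1)` against an arbitrary Haar
measure `μ_U`, with the normalisation constant `c_U` of the product formula in front. Against Rühl's
measure `μ_{U,R} = mulHom_*(haarCircle ⊗ μ_R)` of `T5U11RuhlMeasure` the constant is `1`, and the identity
reads exactly as on `SU(1,1)`:

  `∫_{U(1,1)} ⟨π_k(g x⁻¹) f, h⟩_k ⟨π_k(x) f', h'⟩_k dμ_{U,R}(x) = ⟨f, h'⟩_k ⟨π_k(g) f', h⟩_k / (k - 1)`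

(`integral_matrixCoeffU_mul_inv_mul_ruhlU`), with Godement's idempotent relation
`φ_v * φ_v = (⟨v,v⟩_k/(k-1)) φ_v` in `L¹(U(1,1), μ_{U,R})` (`godement_ruhlU`), its normalised form
(`d_v = (k-1)/⟨v,v⟩_k`, the SAME formal degree as on `SU(1,1)` against `μ_R`; `godement_normalized_ruhlU`)
and the lowest-weight form `(π/(k-1)²) ⟨π_k(g) 1, 1⟩_k` (`godement_lowest_ruhlU`). Nothing is claimed
about (N).

Blind lane: Mathlib + the HodgeRepro2 prefix only; no sorry; axioms ⊆ {propext, Classical.choice,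
Quot.sound}.
-/

namespace Summit.Ventures.HodgeRepro2.T5BergmanGodementRuhlU

open MeasureTheory MeasureTheory.Measure Metric Filter Topology Set
open T5PoincareDensity T5PoincareMeasure T5SU11Unimodular T5U11Unimodular T5U11Product
  T5SU11Fibration T5SU11FibrationHaar T5HaarCircle T5SU11CoefficientL2
open T5BergmanCoefficient T5BergmanPairing T5BergmanFourier T5BergmanParseval T5BergmanProjection
  T5BergmanActStable T5BergmanMatrixCoeff T5BergmanSchur T5BergmanSchurGeneral T5BergmanU11
  T5BergmanSchurGeneralU11 T5BergmanIntegrableKFinite T5BergmanCoefficientLp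
  T5BergmanIntegrableSharpU11 T5BergmanGodementU11 T5U11RuhlMeasure
open scoped Real

variable [MeasurableSpace Circle] [BorelSpace Circle] [MeasurableSpace U11] [BorelSpace U11]

/-- **Godement's convolution identity on `U(1,1)` against `μ_{U,R}`**: for holomorphic
`f, h, f', h' ∈ A_k`, `k ≥ 2` and `g ∈ U(1,1)`,
`∫_{U(1,1)} ⟨π_k(g x⁻¹) f, h⟩_k ⟨π_k(x) f', h'⟩_k dμ_{U,R}(x) = ⟨f, h'⟩_k ⟨π_k(g) f', h⟩_k / (k - 1)`. -/
theorem integral_matrixCoeffU_mul_inv_mul_ruhlU (k : ℕ) (hk : 2 ≤ k) (f h f' h' : ℂ → ℂ)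
    (hf : DifferentiableOn ℂ f (ball 0 1))
    (hfint : IntegrableOn (fun w => ‖f w‖ ^ 2 * (1 - ‖w‖ ^ 2) ^ (k - 2)) (ball (0 : ℂ) 1))
    (hh : DifferentiableOn ℂ h (ball 0 1))
    (hhint : IntegrableOn (fun w => ‖h w‖ ^ 2 * (1 - ‖w‖ ^ 2) ^ (k - 2)) (ball (0 : ℂ) 1))
    (hf' : DifferentiableOn ℂ f' (ball 0 1))
    (hf'int : IntegrableOn (fun w => ‖f' w‖ ^ 2 * (1 - ‖w‖ ^ 2) ^ (k - 2)) (ball (0 : ℂ) 1))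
    (hh' : DifferentiableOn ℂ h' (ball 0 1))
    (hh'int : IntegrableOn (fun w => ‖h' w‖ ^ 2 * (1 - ‖w‖ ^ 2) ^ (k - 2)) (ball (0 : ℂ) 1))
    (g : U11) :
    ∫ x, matrixCoeffU k f h (g * x⁻¹) * matrixCoeffU k f' h' x ∂ruhlU =
      pairing k f h' * matrixCoeffU k f' h g / ((k : ℂ) - 1) := by
  have e := integral_matrixCoeffU_mul_inv_mul ruhlU k hk f h f' h' hf hfint hh hhint hf' hf'int hh'
    hh'int g
  rwa [haarScalarFactor_ruhlU, NNReal.coe_one, one_smul] at e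

/-- **Godement's idempotent relation on `U(1,1)` against `μ_{U,R}`**, `φ_v(g) = ⟨π_k(g) v, v⟩_k`:
`∫_{U(1,1)} φ_v(g x⁻¹) φ_v(x) dμ_{U,R}(x) = (⟨v, v⟩_k / (k - 1)) · φ_v(g)`. -/
theorem godement_ruhlU (k : ℕ) (hk : 2 ≤ k) (v : ℂ → ℂ) (hv : DifferentiableOn ℂ v (ball 0 1))
    (hvint : IntegrableOn (fun w => ‖v w‖ ^ 2 * (1 - ‖w‖ ^ 2) ^ (k - 2)) (ball (0 : ℂ) 1))
    (g : U11) :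
    ∫ x, matrixCoeffU k v v (g * x⁻¹) * matrixCoeffU k v v x ∂ruhlU =
      pairing k v v / ((k : ℂ) - 1) * matrixCoeffU k v v g := by
  rw [integral_matrixCoeffU_mul_inv_mul_ruhlU k hk v v v v hv hvint hv hvint hv hvint hv hvint g]
  ring

/-- The normalised coefficient `d_v · φ_v`, `d_v = (k-1)/⟨v,v⟩_k` — the SAME formal degree as on
`SU(1,1)` against `μ_R` — is a convolution idempotent of `L¹(U(1,1), μ_{U,R})`. -/
theorem godement_normalized_ruhlU (k : ℕ) (hk : 2 ≤ k) (v : ℂ → ℂ)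
    (hv : DifferentiableOn ℂ v (ball 0 1))
    (hvint : IntegrableOn (fun w => ‖v w‖ ^ 2 * (1 - ‖w‖ ^ 2) ^ (k - 2)) (ball (0 : ℂ) 1))
    (hv0 : pairing k v v ≠ 0) (g : U11) :
    ∫ x, (((k : ℂ) - 1) / pairing k v v * matrixCoeffU k v v (g * x⁻¹)) *
        (((k : ℂ) - 1) / pairing k v v * matrixCoeffU k v v x) ∂ruhlU =
      ((k : ℂ) - 1) / pairing k v v * matrixCoeffU k v v g := by
  have hk1 : ((k : ℂ) - 1) ≠ 0 := by
    have : (2 : ℝ) ≤ k := by exact_mod_cast hk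
    have h2 : ((k : ℝ) - 1) ≠ 0 := by linarith
    exact_mod_cast h2
  have e : ∀ x : U11, (((k : ℂ) - 1) / pairing k v v * matrixCoeffU k v v (g * x⁻¹)) *
      (((k : ℂ) - 1) / pairing k v v * matrixCoeffU k v v x) =
      (((k : ℂ) - 1) / pairing k v v) ^ 2 * (matrixCoeffU k v v (g * x⁻¹) * matrixCoeffU k v v x) := by
    intro x
    ring
  simp_rw [e]
  rw [integral_const_mul, godement_ruhlU k hk v hv hvint g]
  field_simp

/-- Godement's relation against `μ_{U,R}` for the lowest-weight vector:
`∫_{U(1,1)} ⟨π_k(g x⁻¹) 1, 1⟩_k ⟨π_k(x) 1, 1⟩_k dμ_{U,R}(x) = (π/(k-1)²) ⟨π_k(g) 1, 1⟩_k`. -/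
theorem godement_lowest_ruhlU (k : ℕ) (hk : 2 ≤ k) (g : U11) :
    ∫ x, matrixCoeffU k lowest lowest (g * x⁻¹) * matrixCoeffU k lowest lowest x ∂ruhlU =
      ((π / ((k : ℝ) - 1) ^ 2 : ℝ) : ℂ) * matrixCoeffU k lowest lowest g := by
  have e := godement_lowestU ruhlU k hk g
  rwa [haarScalarFactor_ruhlU, NNReal.coe_one, one_smul] at e

end Summit.Ventures.HodgeRepro2.T5BergmanGodementRuhlU
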